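import Summits.CriticalPhenomena.PercolationContinuityZ3.Theorems.PercNearOneGluingNoHeavyQuantShapePieceBlob
import Summits.CriticalPhenomena.PercolationContinuityZ3.Theorems.PercNearOneGluingNoHeavyQuantPieceBlobLongCertPC2aGDA
import Summits.CriticalPhenomena.PercolationContinuityZ3.Theorems.PercNearOneGluingNoHeavyQuantPieceBlobLongCertPC2aGDB
import Summits.CriticalPhenomena.PercolationContinuityZ3.Theorems.PercNearOneGluingNoHeavyQuantPieceBlobLongCertPC2aGDC
import Summits.CriticalPhenomena.PercolationContinuityZ3.Theorems.PercNearOneGluingNoHeavyQuantPieceBlobLongCertPC2aXDA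
import Summits.CriticalPhenomena.PercolationContinuityZ3.Theorems.PercNearOneGluingNoHeavyQuantPieceBlobLongCertPC2aXDB
import Summits.CriticalPhenomena.PercolationContinuityZ3.Theorems.PercNearOneGluingNoHeavyQuantPieceBlobLongCertPC2aXDC
import Summits.CriticalPhenomena.PercolationContinuityZ3.Theorems.PercNearOneGluingNoHeavyQuantPieceBlobLongCertPC2bGDA
import Summits.CriticalPhenomena.PercolationContinuityZ3.Theorems.PercNearOneGluingNoHeavyQuantPieceBlobLongCertPC2bGDB
import Summits.CriticalPhenomena.PercolationContinuityZ3.Theorems.PercNearOneGluingNoHeavyQuantPieceBlobLongCertPC2bGDC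
import Summits.CriticalPhenomena.PercolationContinuityZ3.Theorems.PercNearOneGluingNoHeavyQuantPieceBlobLongCertPC2bXDA
import Summits.CriticalPhenomena.PercolationContinuityZ3.Theorems.PercNearOneGluingNoHeavyQuantPieceBlobLongCertPC2bXDB
import Summits.CriticalPhenomena.PercolationContinuityZ3.Theorems.PercNearOneGluingNoHeavyQuantPieceBlobLongCertPC2bXDC
import Summits.CriticalPhenomena.PercolationContinuityZ3.Theorems.PercNearOneGluingNoHeavyQuantPieceBlobLongCertPC2cGDA
import Summits.CriticalPhenomena.PercolationContinuityZ3.Theorems.PercNearOneGluingNoHeavyQuantPieceBlobLongCertPC2cGDB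
import Summits.CriticalPhenomena.PercolationContinuityZ3.Theorems.PercNearOneGluingNoHeavyQuantPieceBlobLongCertPC2cGDC
import Summits.CriticalPhenomena.PercolationContinuityZ3.Theorems.PercNearOneGluingNoHeavyQuantPieceBlobLongCertPC2cXDA
import Summits.CriticalPhenomena.PercolationContinuityZ3.Theorems.PercNearOneGluingNoHeavyQuantPieceBlobLongCertPC2cXDB
import Summits.CriticalPhenomena.PercolationContinuityZ3.Theorems.PercNearOneGluingNoHeavyQuantPieceBlobLongCertPC2cXDC
import HarnessLib

/-!
# QUANT lane R8, T-DEC: THE PIECE BESIDE A BIG BLOB FOR EVERY SHAPE `lo < K ≤ 4lo` AND EVERY GATE — the split cost in the floor regime at every floor (census-1 gen 33)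

builds on p205010 (kernel theorem, internal audit signed; external expert review pending)

Support file (`--supports stmt-CriticalPhenomena-4575`), QUANT lane seat prim-quant-census-1 (gen 33); memo
`run/shared/lean/prim/quant/prim-quant-census-1/g33/WIDE3-G33.md` §4.  Theorems only, standard axioms, no sorries.  This file: `pb_glue_cost`, the case splits `pb_PC2aGD` … `pb_PC2cXD`, and the y-form bricks `pb_PC2a`, `pb_PC2b`, `pb_PC2c` (monotone in the floor).
THE RULE (memo §4; exact regression `g33/code/exp6_pieceblob_rule.py`, 0 failures on 13 shapes `lo < K ≤ 4lo`): per outer gate, the low atom `lo` of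
`S(γ) ∗ blob_{lo+K}(g)` goes to `2lo+K` while `θ₁(ν(lo)+ν(2lo+K)) ≤ ν(2lo+K)` (`θ₁ = max(y, D/(lo+K))`, `D = T − 2lo`); otherwise the flow
SPLITS — `a(1−γ)g(lo+K−D)/D` saturates `2lo+K`, the overflow `a(1−γ)(D−(lo+K)g)/D` goes to the top; for `D ≥ lo+K` everything goes to the top.
Bricks (polynomial inequalities in `lo, K, γ, g, D` (and `y`/`x`), K-units `c = lo/K ∈ [1/4, 1]` split into the boxes `[1/4,1/3]`, `[1/3,1/2]`, `[1/2,1]`):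
PB1/PB2 (top capacity of the overflow: ρ / floor), PC1a–c / PC2a–c (split cost: ρ / floor regime, three budget sub-cases), PD1/PD2 (top capacity,
regime II), PE1/PE2 (top cost, regime II); the floor-regime bricks are certified at the floor bound `ȳ = (2lo+D)·x_max/T₀` (`…GD` / `…XD` for
`x_max = g` / `(lo+Kγ)/(lo+K)`) and transported to every `y ≤ ȳ` by monotonicity (`pb_glue_cap`, `pb_glue_cost`).  Certificates: Handelman products found
by kit (`g33/code/kitjob6`: scipy/HiGHS dual simplex for the support + exact rational repair), checked here by `linarith`.

HONEST STATUS.  Algebra only.  `SiblingStep`, `GluedDominatedMass`, `SDECConvClosed`, `FarTreeRow` OPEN; RATE class (log\*) / honest sentence of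
`run/shared/lean/prim/quant/README.md` unchanged.  [this work].  Nothing here is cited as a published result.  The gluing rows served
[cite: KozmaNitzan2024, Conjecture 3 (p. 15)]; product measure [cite: Grimmett1999, §1.3 p. 10].
-/

noncomputable section

open scoped BigOperators

namespace Summit.CriticalPhenomena.PercolationContinuityZ3.Theorems
namespace Quant
namespace LawDec

/-- monotone glue for the split cost: the certified inequality at the floor bound `ū ≥ u` implies it at `u`. [this work] -/
theorem pb_glue_cost {base bud c2 e1 e2 D u ub Tt : ℝ} (hb : base * D * (Tt - ub) + c2 * ub * e1 * e2 ≤ bud * D * (Tt - ub))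
    (hu : u ≤ ub) (hu0 : 0 ≤ u) (hub : ub < Tt) (_hD : 0 < D) (hc2 : 0 ≤ c2) (he1 : 0 ≤ e1) (he2 : 0 ≤ e2) :
    base * D * (Tt - u) + c2 * u * e1 * e2 ≤ bud * D * (Tt - u) := by
  have hS : 0 ≤ c2 * ub * e1 * e2 := mul_nonneg (mul_nonneg (mul_nonneg hc2 (le_trans hu0 hu)) he1) he2
  have hW : 0 ≤ (bud - base) * D := by
    by_contra hc; push Not at hc
    have : (bud - base) * D * (Tt - ub) < 0 := mul_neg_of_neg_of_pos hc (by linarith)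
    nlinarith
  have h1 : (bud - base) * D * (Tt - ub) ≤ (bud - base) * D * (Tt - u) := mul_le_mul_of_nonneg_left (by linarith) hW
  have h2 : c2 * u * e1 * e2 ≤ c2 * ub * e1 * e2 := by
    have := mul_le_mul_of_nonneg_left hu hc2
    exact mul_le_mul_of_nonneg_right (mul_le_mul_of_nonneg_right this he1) he2
  nlinarith

/-- brick PC2aGD on the whole range (case split over the three shape boxes). [this work] -/
theorem pb_PC2aGD (lo K γ g D : ℝ) (hlo : 0 < lo) (hK1 : lo ≤ K) (hK4 : K ≤ 4 * lo)
    (hγ : lo ≤ K * γ) (hγ1 : γ ≤ 1) (hbig : 2 * lo ≤ (lo + K) * g) (hg1 : g ≤ 1) (hγ0 : 0 ≤ γ) (hg0 : 0 ≤ g) (hD : 0 ≤ D) (hDBg' : (lo + K) * g ≤ D) (hBD' : D ≤ lo + K) (hDmax' : D ≤ (K * γ - lo + (lo + K) * g)) (hBT' : D ≤ K - lo) (hxmG : (lo + K) * g ≤ lo + K * γ) (hTgG : (2 * lo + D) * g ≤ (lo + K * γ + (lo + K) * g)) (hyLG : D * (lo + K * γ + (lo + K) * g) ≤ (2 * lo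 + D) * g * (lo + 2 * K)) :
    (K - D) * ((1 - γ) * g) * D * ((lo + K * γ + (lo + K) * g) - (2 * lo + D) * g) + (2 * K - D) * ((2 * lo + D) * g) * (1 - γ) * (D - (lo + K) * g)
      ≤ ((1 - γ) * (1 - g)) * (lo + D) * D * ((lo + K * γ + (lo + K) * g) - (2 * lo + D) * g) := by
  rcases le_total K (2 * lo) with hK2' | hK2
  · exact pbC_PC2aGD lo K γ g D hlo hK1 hK2' hγ hγ1 hbig hg1 hD hDBg' hBD' hDmax' hBT' hγ0 hg0 hxmG hTgG hyLG
  · rcases le_total K (3 * lo) with hK3' | hK3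
    · exact pbB_PC2aGD lo K γ g D hlo hK2 hK3' hγ hγ1 hbig hg1 hD hDBg' hBD' hDmax' hBT' hγ0 hg0 hxmG hTgG hyLG
    · exact pbA_PC2aGD lo K γ g D hlo hK3 hK4 hγ hγ1 hbig hg1 hD hDBg' hBD' hDmax' hBT' hγ0 hg0 hxmG hTgG hyLG

/-- brick PC2aXD on the whole range (case split over the three shape boxes). [this work] -/
theorem pb_PC2aXD (lo K γ g D : ℝ) (hlo : 0 < lo) (hK1 : lo ≤ K) (hK4 : K ≤ 4 * lo)
    (hγ : lo ≤ K * γ) (hγ1 : γ ≤ 1) (hbig : 2 * lo ≤ (lo + K) * g) (hg1 : g ≤ 1) (hγ0 : 0 ≤ γ) (hg0 : 0 ≤ g) (hD : 0 ≤ D) (hDBg' : (lo + K) * g ≤ D) (hBD' : D ≤ lo + K) (hDmax' : D ≤ (K * γ - lo + (lo + K) * g)) (hBT' : D ≤ K - lo) (hxmX : lo + K * γ ≤ (lo + K) * g) (hTPX : (2 * lo + D) * (lo + K * γ) ≤ (lo + K) * (lo + K * γ + (lo + K) * g)) (hyLX : D * (lo + K * γ + (lo + K) * g) * (lo + K) ≤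 (2 * lo + D) * (lo + K * γ) * (lo + 2 * K)) :
    (K - D) * ((1 - γ) * g) * D * ((lo + K) * (lo + K * γ + (lo + K) * g) - (2 * lo + D) * (lo + K * γ)) + (2 * K - D) * ((2 * lo + D) * (lo + K * γ)) * (1 - γ) * (D - (lo + K) * g)
      ≤ ((1 - γ) * (1 - g)) * (lo + D) * D * ((lo + K) * (lo + K * γ + (lo + K) * g) - (2 * lo + D) * (lo + K * γ)) := by
  rcases le_total K (2 * lo) with hK2' | hK2
  · exact pbC_PC2aXD lo K γ g D hlo hK1 hK2' hγ hγ1 hbig hg1 hD hDBg' hBD' hDmax' hBT' hγ0 hg0 hxmX hTPX hyLX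
  · rcases le_total K (3 * lo) with hK3' | hK3
    · exact pbB_PC2aXD lo K γ g D hlo hK2 hK3' hγ hγ1 hbig hg1 hD hDBg' hBD' hDmax' hBT' hγ0 hg0 hxmX hTPX hyLX
    · exact pbA_PC2aXD lo K γ g D hlo hK3 hK4 hγ hγ1 hbig hg1 hD hDBg' hBD' hDmax' hBT' hγ0 hg0 hxmX hTPX hyLX

/-- brick PC2bGD on the whole range (case split over the three shape boxes). [this work] -/
theorem pb_PC2bGD (lo K γ g D : ℝ) (hlo : 0 < lo) (hK1 : lo ≤ K) (hK4 : K ≤ 4 * lo)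
    (hγ : lo ≤ K * γ) (hγ1 : γ ≤ 1) (hbig : 2 * lo ≤ (lo + K) * g) (hg1 : g ≤ 1) (hγ0 : 0 ≤ γ) (hg0 : 0 ≤ g) (hD : 0 ≤ D) (hDBg' : (lo + K) * g ≤ D) (hBD' : D ≤ lo + K) (hDmax' : D ≤ (K * γ - lo + (lo + K) * g)) (hTB' : K ≤ lo + D) (hh1T' : D ≤ K) (hxmG : (lo + K) * g ≤ lo + K * γ) (hTgG : (2 * lo + D) * g ≤ (lo + K * γ + (lo + K) * g)) (hyLG : D * (lo + K * γ + (lo + K) * g) ≤ (2 * lo + D) * g * (lo + 2 * K)) :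
    (K - D) * ((1 - γ) * g) * D * ((lo + K * γ + (lo + K) * g) - (2 * lo + D) * g) + (2 * K - D) * ((2 * lo + D) * g) * (1 - γ) * (D - (lo + K) * g)
      ≤ (((1 - γ) * (1 - g)) * (lo + D) + (γ * (1 - g)) * (lo + D - K)) * D * ((lo + K * γ + (lo + K) * g) - (2 * lo + D) * g) := by
  rcases le_total K (2 * lo) with hK2' | hK2
  · exact pbC_PC2bGD lo K γ g D hlo hK1 hK2' hγ hγ1 hbig hg1 hD hDBg' hBD' hDmax' hTB' hh1T' hγ0 hg0 hxmG hTgG hyLG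
  · rcases le_total K (3 * lo) with hK3' | hK3
    · exact pbB_PC2bGD lo K γ g D hlo hK2 hK3' hγ hγ1 hbig hg1 hD hDBg' hBD' hDmax' hTB' hh1T' hγ0 hg0 hxmG hTgG hyLG
    · exact pbA_PC2bGD lo K γ g D hlo hK3 hK4 hγ hγ1 hbig hg1 hD hDBg' hBD' hDmax' hTB' hh1T' hγ0 hg0 hxmG hTgG hyLG

/-- brick PC2bXD on the whole range (case split over the three shape boxes). [this work] -/
theorem pb_PC2bXD (lo K γ g D : ℝ) (hlo : 0 < lo) (hK1 : lo ≤ K) (hK4 : K ≤ 4 * lo)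
    (hγ : lo ≤ K * γ) (hγ1 : γ ≤ 1) (hbig : 2 * lo ≤ (lo + K) * g) (hg1 : g ≤ 1) (hγ0 : 0 ≤ γ) (hg0 : 0 ≤ g) (hD : 0 ≤ D) (hDBg' : (lo + K) * g ≤ D) (hBD' : D ≤ lo + K) (hDmax' : D ≤ (K * γ - lo + (lo + K) * g)) (hTB' : K ≤ lo + D) (hh1T' : D ≤ K) (hxmX : lo + K * γ ≤ (lo + K) * g) (hTPX : (2 * lo + D) * (lo + K * γ) ≤ (lo + K) * (lo + K * γ + (lo + K) * g)) (hyLX : D * (lo + K * γ + (lo + K) * g) * (lo + K) ≤ (2 * lo + D) * (lo + K * γ) * (lo + 2 * K)) :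
    (K - D) * ((1 - γ) * g) * D * ((lo + K) * (lo + K * γ + (lo + K) * g) - (2 * lo + D) * (lo + K * γ)) + (2 * K - D) * ((2 * lo + D) * (lo + K * γ)) * (1 - γ) * (D - (lo + K) * g)
      ≤ (((1 - γ) * (1 - g)) * (lo + D) + (γ * (1 - g)) * (lo + D - K)) * D * ((lo + K) * (lo + K * γ + (lo + K) * g) - (2 * lo + D) * (lo + K * γ)) := by
  rcases le_total K (2 * lo) with hK2' | hK2
  · exact pbC_PC2bXD lo K γ g D hlo hK1 hK2' hγ hγ1 hbig hg1 hD hDBg' hBD' hDmax' hTB' hh1T' hγ0 hg0 hxmX hTPX hyLX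
  · rcases le_total K (3 * lo) with hK3' | hK3
    · exact pbB_PC2bXD lo K γ g D hlo hK2 hK3' hγ hγ1 hbig hg1 hD hDBg' hBD' hDmax' hTB' hh1T' hγ0 hg0 hxmX hTPX hyLX
    · exact pbA_PC2bXD lo K γ g D hlo hK3 hK4 hγ hγ1 hbig hg1 hD hDBg' hBD' hDmax' hTB' hh1T' hγ0 hg0 hxmX hTPX hyLX

/-- brick PC2cGD on the whole range (case split over the three shape boxes). [this work] -/
theorem pb_PC2cGD (lo K γ g D : ℝ) (hlo : 0 < lo) (hK1 : lo ≤ K) (hK4 : K ≤ 4 * lo)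
    (hγ : lo ≤ K * γ) (hγ1 : γ ≤ 1) (hbig : 2 * lo ≤ (lo + K) * g) (hg1 : g ≤ 1) (hγ0 : 0 ≤ γ) (hg0 : 0 ≤ g) (hD : 0 ≤ D) (hDBg' : (lo + K) * g ≤ D) (hBD' : D ≤ lo + K) (hDmax' : D ≤ (K * γ - lo + (lo + K) * g)) (hTh1' : K ≤ D) (hxmG : (lo + K) * g ≤ lo + K * γ) (hTgG : (2 * lo + D) * g ≤ (lo + K * γ + (lo + K) * g)) (hyLG : D * (lo + K * γ + (lo + K) * g) ≤ (2 * lo + D) * g * (lo + 2 * K)) :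
    (2 * K - D) * ((2 * lo + D) * g) * (1 - γ) * (D - (lo + K) * g)
      ≤ (((1 - γ) * (1 - g)) * (lo + D) + (γ * (1 - g)) * (lo + D - K) + ((1 - γ) * g) * (D - K)) * D * ((lo + K * γ + (lo + K) * g) - (2 * lo + D) * g) := by
  rcases le_total K (2 * lo) with hK2' | hK2
  · exact pbC_PC2cGD lo K γ g D hlo hK1 hK2' hγ hγ1 hbig hg1 hD hDBg' hBD' hDmax' hTh1' hγ0 hg0 hxmG hTgG hyLG
  · rcases le_total K (3 * lo) with hK3' | hK3
    · exact pbB_PC2cGD lo K γ g D hlo hK2 hK3' hγ hγ1 hbig hg1 hD hDBg' hBD' hDmax' hTh1' hγ0 hg0 hxmG hTgG hyLG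
    · exact pbA_PC2cGD lo K γ g D hlo hK3 hK4 hγ hγ1 hbig hg1 hD hDBg' hBD' hDmax' hTh1' hγ0 hg0 hxmG hTgG hyLG

/-- brick PC2cXD on the whole range (case split over the three shape boxes). [this work] -/
theorem pb_PC2cXD (lo K γ g D : ℝ) (hlo : 0 < lo) (hK1 : lo ≤ K) (hK4 : K ≤ 4 * lo)
    (hγ : lo ≤ K * γ) (hγ1 : γ ≤ 1) (hbig : 2 * lo ≤ (lo + K) * g) (hg1 : g ≤ 1) (hγ0 : 0 ≤ γ) (hg0 : 0 ≤ g) (hD : 0 ≤ D) (hDBg' : (lo + K) * g ≤ D) (hBD' : D ≤ lo + K) (hDmax' : D ≤ (K * γ - lo + (lo + K) * g)) (hTh1' : K ≤ D) (hxmX : lo + K * γ ≤ (lo + K) * g) (hTPX : (2 * lo + D) * (lo + K * γ) ≤ (lo + K) * (lo + K * γ + (lo + K) * g)) (hyLX : D * (lo + K * γ + (lo + K) * g) * (lo + K) ≤ (2 * lo + D) * (lo + K * γ) * (lo + 2 * K)) :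
    (2 * K - D) * ((2 * lo + D) * (lo + K * γ)) * (1 - γ) * (D - (lo + K) * g)
      ≤ (((1 - γ) * (1 - g)) * (lo + D) + (γ * (1 - g)) * (lo + D - K) + ((1 - γ) * g) * (D - K)) * D * ((lo + K) * (lo + K * γ + (lo + K) * g) - (2 * lo + D) * (lo + K * γ)) := by
  rcases le_total K (2 * lo) with hK2' | hK2
  · exact pbC_PC2cXD lo K γ g D hlo hK1 hK2' hγ hγ1 hbig hg1 hD hDBg' hBD' hDmax' hTh1' hγ0 hg0 hxmX hTPX hyLX
  · rcases le_total K (3 * lo) with hK3' | hK3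
    · exact pbB_PC2cXD lo K γ g D hlo hK2 hK3' hγ hγ1 hbig hg1 hD hDBg' hBD' hDmax' hTh1' hγ0 hg0 hxmX hTPX hyLX
    · exact pbA_PC2cXD lo K γ g D hlo hK3 hK4 hγ hγ1 hbig hg1 hD hDBg' hBD' hDmax' hTh1' hγ0 hg0 hxmX hTPX hyLX

/-- brick PC2a (split cost, floor regime, `T < lo+K`) from the `ȳ`-certificates. [this work] -/
theorem pb_PC2a (lo K γ g D y : ℝ) (hlo : 0 < lo) (hK1 : lo ≤ K) (hK4 : K ≤ 4 * lo)
    (hγ : lo ≤ K * γ) (hγ1 : γ < 1) (hbig : 2 * lo ≤ (lo + K) * g) (hg1 : g < 1) (hD : 0 ≤ D) (hDBg' : (lo + K) * g ≤ D) (hBD' : D ≤ lo + K)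
    (hDmax' : D ≤ (K * γ - lo + (lo + K) * g)) (hBT' : D ≤ K - lo) (hy0 : 0 ≤ y) (_hy1 : y ≤ 1) (_hDyB' : y * (lo + K) ≤ D)
    (hyL' : D ≤ y * (lo + 2 * K)) (hyg' : y * (lo + K * γ + (lo + K) * g) ≤ (2 * lo + D) * g)
    (hyB' : y * (lo + K * γ + (lo + K) * g) * (lo + K) ≤ (2 * lo + D) * (lo + K * γ)) :
    (K - D) * ((1 - γ) * g) * D * (1 - y) + (2 * K - D) * y * (1 - γ) * (D - (lo + K) * g)
      ≤ ((1 - γ) * (1 - g)) * (lo + D) * D * (1 - y) := by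
  have hK : 0 < K := lt_of_lt_of_le hlo hK1
  have hγ0 : 0 ≤ γ := by
    by_contra hc; push Not at hc; have := mul_neg_of_pos_of_neg hK hc; linarith
  have hB : 0 < lo + K := by linarith
  have hg0 : 0 ≤ g := by
    by_contra hc; push Not at hc; have := mul_neg_of_pos_of_neg hB hc; linarith
  have hT0 : 0 < lo + K * γ + (lo + K) * g := by have := mul_nonneg hK.le hγ0; have := mul_nonneg hB.le hg0; linarith
  have hT : 2 * lo + D ≤ lo + K * γ + (lo + K) * g := by linarith
  have hD0 : 0 < D := by nlinarith
  have hc2 : 0 ≤ 2 * K - D := by linarith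
  have he1 : 0 ≤ 1 - γ := by linarith
  have he2 : 0 ≤ D - (lo + K) * g := by linarith
  have hyT0 : 0 ≤ y * (lo + K * γ + (lo + K) * g) := mul_nonneg hy0 hT0.le
  rcases le_total ((lo + K) * g) (lo + K * γ) with hxm | hxm
  · have hg1' : g < 1 := hg1
    have hTg : (2 * lo + D) * g < lo + K * γ + (lo + K) * g := by
      have h1 : (2 * lo + D) * g ≤ (lo + K * γ + (lo + K) * g) * g := mul_le_mul_of_nonneg_right hT hg0
      have h2 : (lo + K * γ + (lo + K) * g) * g < (lo + K * γ + (lo + K) * g) * 1 := mul_lt_mul_of_pos_left hg1' hT0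
      linarith
    have hyL : D * (lo + K * γ + (lo + K) * g) ≤ (2 * lo + D) * g * (lo + 2 * K) := by
      have := mul_le_mul_of_nonneg_right hyg' (by linarith : (0 : ℝ) ≤ lo + 2 * K)
      have := mul_le_mul_of_nonneg_right hyL' hT0.le
      nlinarith
    have hb := pb_PC2aGD lo K γ g D hlo hK1 hK4 hγ hγ1.le hbig hg1.le hγ0 hg0 hD hDBg' hBD' hDmax' hBT' hxm hTg.le hyL
    have hb' : (K - D) * ((1 - γ) * g) * D * ((lo + K * γ + (lo + K) * g) - (2 * lo + D) * g) + (2 * K - D) * ((2 * lo + D) * g) * (1 - γ) * (D - (lo + K) * g)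
        ≤ (1 - γ) * (1 - g) * (lo + D) * D * ((lo + K * γ + (lo + K) * g) - (2 * lo + D) * g) := by
      have e : ((1 - γ) * (1 - g)) * (lo + D) * D * ((lo + K * γ + (lo + K) * g) - (2 * lo + D) * g)
          = (1 - γ) * (1 - g) * (lo + D) * D * ((lo + K * γ + (lo + K) * g) - (2 * lo + D) * g) := by ring
      rw [← e]; exact hb
    have h := pb_glue_cost (u := y * (lo + K * γ + (lo + K) * g)) hb' hyg' hyT0 hTg hD0 hc2 he1 he2
    have e1 : (K - D) * ((1 - γ) * g) * D * ((lo + K * γ + (lo + K) * g) - y * (lo + K * γ + (lo + K) * g))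
        + (2 * K - D) * (y * (lo + K * γ + (lo + K) * g)) * (1 - γ) * (D - (lo + K) * g)
        = (lo + K * γ + (lo + K) * g) * ((K - D) * ((1 - γ) * g) * D * (1 - y) + (2 * K - D) * y * (1 - γ) * (D - (lo + K) * g)) := by ring
    have e2 : (1 - γ) * (1 - g) * (lo + D) * D * ((lo + K * γ + (lo + K) * g) - y * (lo + K * γ + (lo + K) * g))
        = (lo + K * γ + (lo + K) * g) * (((1 - γ) * (1 - g)) * (lo + D) * D * (1 - y)) := by ring
    rw [e1, e2] at h
    exact le_of_mul_le_mul_left h hT0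
  · have hP0 : 0 < lo + K * γ := by have := mul_nonneg hK.le hγ0; linarith
    have hγ1' : γ < 1 := hγ1
    have hTP : (2 * lo + D) * (lo + K * γ) < (lo + K) * (lo + K * γ + (lo + K) * g) := by
      have h1 : (2 * lo + D) * (lo + K * γ) ≤ (lo + K * γ + (lo + K) * g) * (lo + K * γ) := mul_le_mul_of_nonneg_right hT hP0.le
      have h3 : lo + K * γ < lo + K := by have := mul_lt_mul_of_pos_left hγ1' hK; linarith
      have h2 : (lo + K * γ + (lo + K) * g) * (lo + K * γ) < (lo + K * γ + (lo + K) * g) * (lo + K) := mul_lt_mul_of_pos_left h3 hT0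
      linarith
    have hyL : D * (lo + K * γ + (lo + K) * g) * (lo + K) ≤ (2 * lo + D) * (lo + K * γ) * (lo + 2 * K) := by
      have h1 := mul_le_mul_of_nonneg_right hyB' (by linarith : (0 : ℝ) ≤ lo + 2 * K)
      have h2 := mul_le_mul_of_nonneg_right (mul_le_mul_of_nonneg_right hyL' hT0.le) hB.le
      nlinarith
    have hb := pb_PC2aXD lo K γ g D hlo hK1 hK4 hγ hγ1.le hbig hg1.le hγ0 hg0 hD hDBg' hBD' hDmax' hBT' hxm hTP.le hyL
    have hb' : (K - D) * ((1 - γ) * g) * D * ((lo + K) * (lo + K * γ + (lo + K) * g) - (2 * lo + D) * (lo + K * γ))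
        + (2 * K - D) * ((2 * lo + D) * (lo + K * γ)) * (1 - γ) * (D - (lo + K) * g)
        ≤ (1 - γ) * (1 - g) * (lo + D) * D * ((lo + K) * (lo + K * γ + (lo + K) * g) - (2 * lo + D) * (lo + K * γ)) := by
      have e : ((1 - γ) * (1 - g)) * (lo + D) * D * ((lo + K) * (lo + K * γ + (lo + K) * g) - (2 * lo + D) * (lo + K * γ))
          = (1 - γ) * (1 - g) * (lo + D) * D * ((lo + K) * (lo + K * γ + (lo + K) * g) - (2 * lo + D) * (lo + K * γ)) := by ring
      rw [← e]; exact hb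
    have hu0 : 0 ≤ y * (lo + K * γ + (lo + K) * g) * (lo + K) := mul_nonneg hyT0 hB.le
    have h := pb_glue_cost (u := y * (lo + K * γ + (lo + K) * g) * (lo + K)) hb' hyB' hu0 hTP hD0 hc2 he1 he2
    have e1 : (K - D) * ((1 - γ) * g) * D * ((lo + K) * (lo + K * γ + (lo + K) * g) - y * (lo + K * γ + (lo + K) * g) * (lo + K))
        + (2 * K - D) * (y * (lo + K * γ + (lo + K) * g) * (lo + K)) * (1 - γ) * (D - (lo + K) * g)
        = ((lo + K * γ + (lo + K) * g) * (lo + K)) * ((K - D) * ((1 - γ) * g) * D * (1 - y) + (2 * K - D) * y * (1 - γ) * (D - (lo + K) * g)) := by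
      ring
    have e2 : (1 - γ) * (1 - g) * (lo + D) * D * ((lo + K) * (lo + K * γ + (lo + K) * g) - y * (lo + K * γ + (lo + K) * g) * (lo + K))
        = ((lo + K * γ + (lo + K) * g) * (lo + K)) * (((1 - γ) * (1 - g)) * (lo + D) * D * (1 - y)) := by ring
    rw [e1, e2] at h
    exact le_of_mul_le_mul_left h (mul_pos hT0 hB)

/-- brick PC2b (split cost, floor regime, `lo+K ≤ T < 2lo+K`) from the `ȳ`-certificates. [this work] -/
theorem pb_PC2b (lo K γ g D y : ℝ) (hlo : 0 < lo) (hK1 : lo ≤ K) (hK4 : K ≤ 4 * lo)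
    (hγ : lo ≤ K * γ) (hγ1 : γ < 1) (hbig : 2 * lo ≤ (lo + K) * g) (hg1 : g < 1) (hD : 0 ≤ D) (hDBg' : (lo + K) * g ≤ D) (hBD' : D ≤ lo + K)
    (hDmax' : D ≤ (K * γ - lo + (lo + K) * g)) (hTB' : K ≤ lo + D) (hh1T' : D ≤ K) (hy0 : 0 ≤ y) (_hy1 : y ≤ 1) (_hDyB' : y * (lo + K) ≤ D)
    (hyL' : D ≤ y * (lo + 2 * K)) (hyg' : y * (lo + K * γ + (lo + K) * g) ≤ (2 * lo + D) * g)
    (hyB' : y * (lo + K * γ + (lo + K) * g) * (lo + K) ≤ (2 * lo + D) * (lo + K * γ)) :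
    (K - D) * ((1 - γ) * g) * D * (1 - y) + (2 * K - D) * y * (1 - γ) * (D - (lo + K) * g)
      ≤ (((1 - γ) * (1 - g)) * (lo + D) + (γ * (1 - g)) * (lo + D - K)) * D * (1 - y) := by
  have hK : 0 < K := lt_of_lt_of_le hlo hK1
  have hγ0 : 0 ≤ γ := by
    by_contra hc; push Not at hc; have := mul_neg_of_pos_of_neg hK hc; linarith
  have hB : 0 < lo + K := by linarith
  have hg0 : 0 ≤ g := by
    by_contra hc; push Not at hc; have := mul_neg_of_pos_of_neg hB hc; linarith
  have hT0 : 0 < lo + K * γ + (lo + K) * g := by have := mul_nonneg hK.le hγ0; have := mul_nonneg hB.le hg0; linarith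
  have hT : 2 * lo + D ≤ lo + K * γ + (lo + K) * g := by linarith
  have hD0 : 0 < D := by nlinarith
  have hc2 : 0 ≤ 2 * K - D := by linarith
  have he1 : 0 ≤ 1 - γ := by linarith
  have he2 : 0 ≤ D - (lo + K) * g := by linarith
  have hyT0 : 0 ≤ y * (lo + K * γ + (lo + K) * g) := mul_nonneg hy0 hT0.le
  rcases le_total ((lo + K) * g) (lo + K * γ) with hxm | hxm
  · have hg1' : g < 1 := hg1
    have hTg : (2 * lo + D) * g < lo + K * γ + (lo + K) * g := by
      have h1 : (2 * lo + D) * g ≤ (lo + K * γ + (lo + K) * g) * g := mul_le_mul_of_nonneg_right hT hg0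
      have h2 : (lo + K * γ + (lo + K) * g) * g < (lo + K * γ + (lo + K) * g) * 1 := mul_lt_mul_of_pos_left hg1' hT0
      linarith
    have hyL : D * (lo + K * γ + (lo + K) * g) ≤ (2 * lo + D) * g * (lo + 2 * K) := by
      have := mul_le_mul_of_nonneg_right hyg' (by linarith : (0 : ℝ) ≤ lo + 2 * K)
      have := mul_le_mul_of_nonneg_right hyL' hT0.le
      nlinarith
    have hb := pb_PC2bGD lo K γ g D hlo hK1 hK4 hγ hγ1.le hbig hg1.le hγ0 hg0 hD hDBg' hBD' hDmax' hTB' hh1T' hxm hTg.le hyL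
    have hb' : (K - D) * ((1 - γ) * g) * D * ((lo + K * γ + (lo + K) * g) - (2 * lo + D) * g) + (2 * K - D) * ((2 * lo + D) * g) * (1 - γ) * (D - (lo + K) * g)
        ≤ (((1 - γ) * (1 - g)) * (lo + D) + (γ * (1 - g)) * (lo + D - K)) * D * ((lo + K * γ + (lo + K) * g) - (2 * lo + D) * g) := hb
    have h := pb_glue_cost (u := y * (lo + K * γ + (lo + K) * g)) hb' hyg' hyT0 hTg hD0 hc2 he1 he2
    have e1 : (K - D) * ((1 - γ) * g) * D * ((lo + K * γ + (lo + K) * g) - y * (lo + K * γ + (lo + K) * g))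
        + (2 * K - D) * (y * (lo + K * γ + (lo + K) * g)) * (1 - γ) * (D - (lo + K) * g)
        = (lo + K * γ + (lo + K) * g) * ((K - D) * ((1 - γ) * g) * D * (1 - y) + (2 * K - D) * y * (1 - γ) * (D - (lo + K) * g)) := by ring
    have e2 : (((1 - γ) * (1 - g)) * (lo + D) + (γ * (1 - g)) * (lo + D - K)) * D * ((lo + K * γ + (lo + K) * g) - y * (lo + K * γ + (lo + K) * g))
        = (lo + K * γ + (lo + K) * g) * ((((1 - γ) * (1 - g)) * (lo + D) + (γ * (1 - g)) * (lo + D - K)) * D * (1 - y)) := by ring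
    rw [e1, e2] at h
    exact le_of_mul_le_mul_left h hT0
  · have hP0 : 0 < lo + K * γ := by have := mul_nonneg hK.le hγ0; linarith
    have hγ1' : γ < 1 := hγ1
    have hTP : (2 * lo + D) * (lo + K * γ) < (lo + K) * (lo + K * γ + (lo + K) * g) := by
      have h1 : (2 * lo + D) * (lo + K * γ) ≤ (lo + K * γ + (lo + K) * g) * (lo + K * γ) := mul_le_mul_of_nonneg_right hT hP0.le
      have h3 : lo + K * γ < lo + K := by have := mul_lt_mul_of_pos_left hγ1' hK; linarith
      have h2 : (lo + K * γ + (lo + K) * g) * (lo + K * γ) < (lo + K * γ + (lo + K) * g) * (lo + K) := mul_lt_mul_of_pos_left h3 hT0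
      linarith
    have hyL : D * (lo + K * γ + (lo + K) * g) * (lo + K) ≤ (2 * lo + D) * (lo + K * γ) * (lo + 2 * K) := by
      have h1 := mul_le_mul_of_nonneg_right hyB' (by linarith : (0 : ℝ) ≤ lo + 2 * K)
      have h2 := mul_le_mul_of_nonneg_right (mul_le_mul_of_nonneg_right hyL' hT0.le) hB.le
      nlinarith
    have hb := pb_PC2bXD lo K γ g D hlo hK1 hK4 hγ hγ1.le hbig hg1.le hγ0 hg0 hD hDBg' hBD' hDmax' hTB' hh1T' hxm hTP.le hyL
    have hb' : (K - D) * ((1 - γ) * g) * D * ((lo + K) * (lo + K * γ + (lo + K) * g) - (2 * lo + D) * (lo + K * γ))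
        + (2 * K - D) * ((2 * lo + D) * (lo + K * γ)) * (1 - γ) * (D - (lo + K) * g)
        ≤ (((1 - γ) * (1 - g)) * (lo + D) + (γ * (1 - g)) * (lo + D - K)) * D * ((lo + K) * (lo + K * γ + (lo + K) * g) - (2 * lo + D) * (lo + K * γ)) := hb
    have hu0 : 0 ≤ y * (lo + K * γ + (lo + K) * g) * (lo + K) := mul_nonneg hyT0 hB.le
    have h := pb_glue_cost (u := y * (lo + K * γ + (lo + K) * g) * (lo + K)) hb' hyB' hu0 hTP hD0 hc2 he1 he2
    have e1 : (K - D) * ((1 - γ) * g) * D * ((lo + K) * (lo + K * γ + (lo + K) * g) - y * (lo + K * γ + (lo + K) * g) * (lo + K))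
        + (2 * K - D) * (y * (lo + K * γ + (lo + K) * g) * (lo + K)) * (1 - γ) * (D - (lo + K) * g)
        = ((lo + K * γ + (lo + K) * g) * (lo + K)) * ((K - D) * ((1 - γ) * g) * D * (1 - y) + (2 * K - D) * y * (1 - γ) * (D - (lo + K) * g)) := by
      ring
    have e2 : (((1 - γ) * (1 - g)) * (lo + D) + (γ * (1 - g)) * (lo + D - K)) * D * ((lo + K) * (lo + K * γ + (lo + K) * g) - y * (lo + K * γ + (lo + K) * g) * (lo + K))
        = ((lo + K * γ + (lo + K) * g) * (lo + K)) * ((((1 - γ) * (1 - g)) * (lo + D) + (γ * (1 - g)) * (lo + D - K)) * D * (1 - y)) := by ring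
    rw [e1, e2] at h
    exact le_of_mul_le_mul_left h (mul_pos hT0 hB)

/-- brick PC2c (split cost, floor regime, `T ≥ 2lo+K`) from the `ȳ`-certificates. [this work] -/
theorem pb_PC2c (lo K γ g D y : ℝ) (hlo : 0 < lo) (hK1 : lo ≤ K) (hK4 : K ≤ 4 * lo)
    (hγ : lo ≤ K * γ) (hγ1 : γ < 1) (hbig : 2 * lo ≤ (lo + K) * g) (hg1 : g < 1) (hD : 0 ≤ D) (hDBg' : (lo + K) * g ≤ D) (hBD' : D ≤ lo + K)
    (hDmax' : D ≤ (K * γ - lo + (lo + K) * g)) (hTh1' : K ≤ D) (hy0 : 0 ≤ y) (_hy1 : y ≤ 1) (_hDyB' : y * (lo + K) ≤ D)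
    (hyL' : D ≤ y * (lo + 2 * K)) (hyg' : y * (lo + K * γ + (lo + K) * g) ≤ (2 * lo + D) * g)
    (hyB' : y * (lo + K * γ + (lo + K) * g) * (lo + K) ≤ (2 * lo + D) * (lo + K * γ)) :
    (2 * K - D) * y * (1 - γ) * (D - (lo + K) * g)
      ≤ (((1 - γ) * (1 - g)) * (lo + D) + (γ * (1 - g)) * (lo + D - K) + ((1 - γ) * g) * (D - K)) * D * (1 - y) := by
  have hK : 0 < K := lt_of_lt_of_le hlo hK1
  have hγ0 : 0 ≤ γ := by
    by_contra hc; push Not at hc; have := mul_neg_of_pos_of_neg hK hc; linarith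
  have hB : 0 < lo + K := by linarith
  have hg0 : 0 ≤ g := by
    by_contra hc; push Not at hc; have := mul_neg_of_pos_of_neg hB hc; linarith
  have hT0 : 0 < lo + K * γ + (lo + K) * g := by have := mul_nonneg hK.le hγ0; have := mul_nonneg hB.le hg0; linarith
  have hT : 2 * lo + D ≤ lo + K * γ + (lo + K) * g := by linarith
  have hD0 : 0 < D := by nlinarith
  have hc2 : 0 ≤ 2 * K - D := by linarith
  have he1 : 0 ≤ 1 - γ := by linarith
  have he2 : 0 ≤ D - (lo + K) * g := by linarith
  have hyT0 : 0 ≤ y * (lo + K * γ + (lo + K) * g) := mul_nonneg hy0 hT0.le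
  rcases le_total ((lo + K) * g) (lo + K * γ) with hxm | hxm
  · have hg1' : g < 1 := hg1
    have hTg : (2 * lo + D) * g < lo + K * γ + (lo + K) * g := by
      have h1 : (2 * lo + D) * g ≤ (lo + K * γ + (lo + K) * g) * g := mul_le_mul_of_nonneg_right hT hg0
      have h2 : (lo + K * γ + (lo + K) * g) * g < (lo + K * γ + (lo + K) * g) * 1 := mul_lt_mul_of_pos_left hg1' hT0
      linarith
    have hyL : D * (lo + K * γ + (lo + K) * g) ≤ (2 * lo + D) * g * (lo + 2 * K) := by
      have := mul_le_mul_of_nonneg_right hyg' (by linarith : (0 : ℝ) ≤ lo + 2 * K)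
      have := mul_le_mul_of_nonneg_right hyL' hT0.le
      nlinarith
    have hb := pb_PC2cGD lo K γ g D hlo hK1 hK4 hγ hγ1.le hbig hg1.le hγ0 hg0 hD hDBg' hBD' hDmax' hTh1' hxm hTg.le hyL
    have hb' : 0 * D * ((lo + K * γ + (lo + K) * g) - (2 * lo + D) * g) + (2 * K - D) * ((2 * lo + D) * g) * (1 - γ) * (D - (lo + K) * g)
        ≤ (((1 - γ) * (1 - g)) * (lo + D) + (γ * (1 - g)) * (lo + D - K) + ((1 - γ) * g) * (D - K)) * D * ((lo + K * γ + (lo + K) * g) - (2 * lo + D) * g) := by rw [zero_mul, zero_mul, zero_add]; exact hb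
    have h := pb_glue_cost (u := y * (lo + K * γ + (lo + K) * g)) hb' hyg' hyT0 hTg hD0 hc2 he1 he2
    have e1 : 0 * D * ((lo + K * γ + (lo + K) * g) - y * (lo + K * γ + (lo + K) * g))
        + (2 * K - D) * (y * (lo + K * γ + (lo + K) * g)) * (1 - γ) * (D - (lo + K) * g)
        = (lo + K * γ + (lo + K) * g) * ((2 * K - D) * y * (1 - γ) * (D - (lo + K) * g)) := by ring
    have e2 : (((1 - γ) * (1 - g)) * (lo + D) + (γ * (1 - g)) * (lo + D - K) + ((1 - γ) * g) * (D - K)) * D * ((lo + K * γ + (lo + K) * g) - y * (lo + K * γ + (lo + K) * g))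
        = (lo + K * γ + (lo + K) * g) * ((((1 - γ) * (1 - g)) * (lo + D) + (γ * (1 - g)) * (lo + D - K) + ((1 - γ) * g) * (D - K)) * D * (1 - y)) := by ring
    rw [e1, e2] at h
    exact le_of_mul_le_mul_left h hT0
  · have hP0 : 0 < lo + K * γ := by have := mul_nonneg hK.le hγ0; linarith
    have hγ1' : γ < 1 := hγ1
    have hTP : (2 * lo + D) * (lo + K * γ) < (lo + K) * (lo + K * γ + (lo + K) * g) := by
      have h1 : (2 * lo + D) * (lo + K * γ) ≤ (lo + K * γ + (lo + K) * g) * (lo + K * γ) := mul_le_mul_of_nonneg_right hT hP0.le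
      have h3 : lo + K * γ < lo + K := by have := mul_lt_mul_of_pos_left hγ1' hK; linarith
      have h2 : (lo + K * γ + (lo + K) * g) * (lo + K * γ) < (lo + K * γ + (lo + K) * g) * (lo + K) := mul_lt_mul_of_pos_left h3 hT0
      linarith
    have hyL : D * (lo + K * γ + (lo + K) * g) * (lo + K) ≤ (2 * lo + D) * (lo + K * γ) * (lo + 2 * K) := by
      have h1 := mul_le_mul_of_nonneg_right hyB' (by linarith : (0 : ℝ) ≤ lo + 2 * K)
      have h2 := mul_le_mul_of_nonneg_right (mul_le_mul_of_nonneg_right hyL' hT0.le) hB.le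
      nlinarith
    have hb := pb_PC2cXD lo K γ g D hlo hK1 hK4 hγ hγ1.le hbig hg1.le hγ0 hg0 hD hDBg' hBD' hDmax' hTh1' hxm hTP.le hyL
    have hb' : 0 * D * ((lo + K) * (lo + K * γ + (lo + K) * g) - (2 * lo + D) * (lo + K * γ))
        + (2 * K - D) * ((2 * lo + D) * (lo + K * γ)) * (1 - γ) * (D - (lo + K) * g)
        ≤ (((1 - γ) * (1 - g)) * (lo + D) + (γ * (1 - g)) * (lo + D - K) + ((1 - γ) * g) * (D - K)) * D * ((lo + K) * (lo + K * γ + (lo + K) * g) - (2 * lo + D) * (lo + K * γ)) := by rw [zero_mul, zero_mul, zero_add]; exact hb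
    have hu0 : 0 ≤ y * (lo + K * γ + (lo + K) * g) * (lo + K) := mul_nonneg hyT0 hB.le
    have h := pb_glue_cost (u := y * (lo + K * γ + (lo + K) * g) * (lo + K)) hb' hyB' hu0 hTP hD0 hc2 he1 he2
    have e1 : 0 * D * ((lo + K) * (lo + K * γ + (lo + K) * g) - y * (lo + K * γ + (lo + K) * g) * (lo + K))
        + (2 * K - D) * (y * (lo + K * γ + (lo + K) * g) * (lo + K)) * (1 - γ) * (D - (lo + K) * g)
        = ((lo + K * γ + (lo + K) * g) * (lo + K)) * ((2 * K - D) * y * (1 - γ) * (D - (lo + K) * g)) := by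
      ring
    have e2 : (((1 - γ) * (1 - g)) * (lo + D) + (γ * (1 - g)) * (lo + D - K) + ((1 - γ) * g) * (D - K)) * D * ((lo + K) * (lo + K * γ + (lo + K) * g) - y * (lo + K * γ + (lo + K) * g) * (lo + K))
        = ((lo + K * γ + (lo + K) * g) * (lo + K)) * ((((1 - γ) * (1 - g)) * (lo + D) + (γ * (1 - g)) * (lo + D - K) + ((1 - γ) * g) * (D - K)) * D * (1 - y)) := by ring
    rw [e1, e2] at h
    exact le_of_mul_le_mul_left h (mul_pos hT0 hB)

end LawDec
end Quant
end Summit.CriticalPhenomena.PercolationContinuityZ3.Theorems
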